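import Mathlib.LinearAlgebra.Matrix.Rank
import Mathlib.LinearAlgebra.Matrix.SchurComplement
import Mathlib.Algebra.MvPolynomial.Funext
import Mathlib.Algebra.Ring.GeomSum
import HarnessLib

/-!
# Symbolic matrices: a maximal non-vanishing minor and the translated low-rank decomposition
(Efremenko–Garg–Oliveira–Wigderson 2018, §2.2 and Lemma 3.2, first half)

Topic: `Literature/Computability/AlgebraicComplexity`. This file is the first part of the proof of
the rank-method barriers `EGOW2018_thm44` / `EGOW2018_thm42` (`RankMethodBarriers.lean`).

Let `F` be an infinite field and `P ∈ Mat_ι(F[x])` a matrix with polynomial entries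
(`Matrix ι ι (MvPolynomial σ F)`). The paper argues with the symbolic rank
`rk_{F(x)} P` (Prop. 2.6, Lemma 2.7) and a rank decomposition over the field of rational
functions (proof of Lemma 3.2). We avoid `F(x)` altogether:

* `exists_maxMinor_factorization` — choose `ρ` maximal such that some `ρ × ρ` minor of some
  evaluation `P(b)` is non-zero, with witnesses `a`, rows `rI`, columns `cI`; then every
  `(ρ+1) × (ρ+1)` minor of every `P(b)` vanishes, `ρ ≤ rank P(a)`, and with `Q = P[rI, cI]`,
  `δ = det Q ≠ 0` one has the polynomial identity `δ • P = P[·, cI] · adj Q · P[rI, ·]`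
  (proved pointwise from the bordered-determinant expansion `Matrix.det_fromBlocks₁₁` where
  `δ(b) ≠ 0`, then `δ · (difference)` vanishes identically, `MvPolynomial.funext`). This replaces
  Lemma 2.7 ("`rk P(a) ≤ r` for all `a` implies `rk_{F(x)} P ≤ r`") and the rational decomposition.
* `exists_translate_decomposition` — Lemma 3.2, first half: translating by `a`
  (`x ↦ x + a`, the ring map `eval₂Hom C (X + C a)`), `δ(x + a) = δ(a) · (1 - ε(x))` with
  `ε(0) = 0`, and multiplying by the truncated geometric series `∑_{k ≤ D} ε^k` gives
  `P(x + a) = P(x + a)[·, cI] · B'(x) + ε^{D+1} • P(x + a)` with a POLYNOMIAL matrix `B'`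
  ("from the power series expansion of `1/(1-x)` … `H_{≤ d}`", p. 10 of the paper).

The homogeneous / set-multilinear component extraction (Lemma 3.2 second half, Lemmas 3.3, 3.5)
is in `SymbolicMatrixDecomposition.lean`. Nothing here is specific to tensors or Waring rank.

## References

* [EfremenkoGargOliveiraWigderson2018] K. Efremenko, A. Garg, R. Oliveira, A. Wigderson,
  *Barriers for rank methods in arithmetic complexity*, ITCS 2018; arXiv:1710.09502, §2.2
  (Prop. 2.6, Lemma 2.7), §3.1 (Lemma 3.2).
-/

noncomputable section

open MvPolynomial

namespace Literature.Computability.AlgebraicComplexity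

/-! ## The bordered-minor identity at a point -/

section Bordered

variable {K : Type*} [Field K] {ι : Type*}

/-- If the `ρ × ρ` submatrix `Q = M[rI, cI]` is non-singular and every `(ρ+1) × (ρ+1)` submatrix of
`M` is singular, then `det Q · M_{ij} = (M[·, cI] · adj Q · M[rI, ·])_{ij}`: the bordered determinant
`det [[Q, M[rI, j]], [M[i, cI], M_{ij}]] = det Q · (M_{ij} - M[i,cI] Q⁻¹ M[rI,j])` vanishes
(EGOW 2018 use this through the symbolic rank, Prop. 2.6 / Lemma 2.7). [cite: EfremenkoGargOliveiraWigderson2018, Lemma 2.7] -/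
theorem det_mul_apply_eq_of_minors_vanish {ρ : ℕ} (M : Matrix ι ι K) (rI cI : Fin ρ → ι)
    (hQ : (M.submatrix rI cI).det ≠ 0)
    (hmin : ∀ r' c' : Fin (ρ + 1) → ι, (M.submatrix r' c').det = 0) (i j : ι) :
    (M.submatrix rI cI).det * M i j =
      (M.submatrix id cI * (M.submatrix rI cI).adjugate * M.submatrix rI id) i j := by
  haveI : Invertible (M.submatrix rI cI) :=
    (M.submatrix rI cI).invertibleOfIsUnitDet (isUnit_iff_ne_zero.mpr hQ)
  let Bc : Matrix (Fin ρ) (Fin 1) K := Matrix.of fun k _ => M (rI k) j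
  let Cr : Matrix (Fin 1) (Fin ρ) K := Matrix.of fun _ l => M i (cI l)
  let Dd : Matrix (Fin 1) (Fin 1) K := Matrix.of fun _ _ => M i j
  have hB : Matrix.fromBlocks (M.submatrix rI cI) Bc Cr Dd =
      M.submatrix (Sum.elim rI (fun _ => i)) (Sum.elim cI (fun _ => j)) := by
    ext (k | k) (l | l) <;> rfl
  have hdetB : (Matrix.fromBlocks (M.submatrix rI cI) Bc Cr Dd).det = 0 := by
    have h := hmin (Sum.elim rI (fun _ => i) ∘ finSumFinEquiv.symm)
      (Sum.elim cI (fun _ => j) ∘ finSumFinEquiv.symm)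
    rw [← Matrix.submatrix_submatrix, ← hB] at h
    rwa [Matrix.det_submatrix_equiv_self] at h
  have hdet := Matrix.det_fromBlocks₁₁ (M.submatrix rI cI) Bc Cr Dd
  rw [hdetB, Matrix.det_unique (Dd - Cr * ⅟(M.submatrix rI cI) * Bc)] at hdet
  have hinv : ⅟(M.submatrix rI cI) = ((M.submatrix rI cI).det)⁻¹ • (M.submatrix rI cI).adjugate := by
    rw [Matrix.invOf_eq_nonsing_inv, Matrix.inv_def, Ring.inverse_eq_inv]
  have h0 : (Dd - Cr * ⅟(M.submatrix rI cI) * Bc) default default = 0 := by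
    rcases mul_eq_zero.mp hdet.symm with h | h
    · exact absurd h hQ
    · exact h
  rw [hinv] at h0
  simp only [Matrix.sub_apply, Matrix.mul_apply, Matrix.smul_apply, Matrix.of_apply, Dd, Cr, Bc,
    smul_eq_mul, sub_eq_zero] at h0
  -- h0 : M i j = ∑ x, (∑ x_1, M i (cI x_1) * (det⁻¹ * adj x_1 x)) * M (rI x) j
  rw [h0, Finset.mul_sum]
  simp only [Matrix.mul_apply, Matrix.submatrix_apply, id]
  refine Finset.sum_congr rfl fun k _ => ?_
  rw [← mul_assoc, Finset.mul_sum, Finset.sum_mul, Finset.sum_mul]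
  refine Finset.sum_congr rfl fun l _ => ?_
  rw [mul_left_comm (M i (cI l)), ← mul_assoc, ← mul_assoc, mul_inv_cancel₀ hQ, one_mul]

end Bordered

/-! ## A maximal non-vanishing minor of a symbolic matrix -/

section MaxMinor

variable {F : Type*} [Field F] {σ : Type*} {ι : Type*}

/-- Evaluation commutes with taking the determinant of a submatrix. [folklore] -/
theorem eval_det_submatrix {ρ : ℕ} (P : Matrix ι ι (MvPolynomial σ F)) (b : σ → F)
    (r c : Fin ρ → ι) :
    eval b (P.submatrix r c).det = ((P.map (eval b)).submatrix r c).det := by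
  rw [RingHom.map_det, RingHom.mapMatrix_apply, Matrix.submatrix_map]

/-- Evaluation commutes with the product `P[·, cI] · adj P[rI, cI] · P[rI, ·]`. [folklore] -/
theorem eval_colAdjRow_apply {ρ : ℕ} (P : Matrix ι ι (MvPolynomial σ F)) (b : σ → F)
    (rI cI : Fin ρ → ι) (i j : ι) :
    eval b ((P.submatrix id cI * (P.submatrix rI cI).adjugate * P.submatrix rI id) i j) =
      ((P.map (eval b)).submatrix id cI * ((P.map (eval b)).submatrix rI cI).adjugate *
        (P.map (eval b)).submatrix rI id) i j := by
  have h1 : ∀ A : Matrix ι ι (MvPolynomial σ F), eval b (A i j) = (A.map (eval b)) i j :=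
    fun A => rfl
  rw [h1, Matrix.map_mul, Matrix.map_mul, ← RingHom.mapMatrix_apply (eval b) (P.submatrix rI cI).adjugate,
    RingHom.map_adjugate, RingHom.mapMatrix_apply]
  simp only [← Matrix.submatrix_map]

variable [Infinite F] [Fintype ι]

/-- **Maximal non-vanishing minor and the adjugate factorization** (replaces EGOW 2018, Prop. 2.6 /
Lemma 2.7 and the rational rank decomposition in the proof of Lemma 3.2). For a matrix `P` with
entries in `F[x]`, `F` an infinite field: there are `ρ`, a point `a`, rows `rI` and columns `cI`
such that the minor `Q = P[rI, cI]` has `det Q (a) ≠ 0` (so `ρ ≤ rank P(a)`), every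
`(ρ+1) × (ρ+1)` minor of every evaluation `P(b)` vanishes, and
`det Q • P = P[·, cI] · adj Q · P[rI, ·]` identically. [cite: EfremenkoGargOliveiraWigderson2018, Lemma 2.7 and Lemma 3.2] -/
theorem exists_maxMinor_factorization (P : Matrix ι ι (MvPolynomial σ F)) :
    ∃ (ρ : ℕ) (a : σ → F) (rI cI : Fin ρ → ι),
      eval a (P.submatrix rI cI).det ≠ 0 ∧
      ρ ≤ (P.map (eval a)).rank ∧
      (∀ (b : σ → F) (r' c' : Fin (ρ + 1) → ι), ((P.map (eval b)).submatrix r' c').det = 0) ∧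
      (P.submatrix rI cI).det • P =
        P.submatrix id cI * (P.submatrix rI cI).adjugate * P.submatrix rI id := by
  classical
  let Good : ℕ → Prop := fun k =>
    ∃ (b : σ → F) (r c : Fin k → ι), ((P.map (eval b)).submatrix r c).det ≠ 0
  have hGood0 : Good 0 := ⟨fun _ => 0, Fin.elim0, Fin.elim0, by simp⟩
  have hbound : ∀ k, Good k → k ≤ Fintype.card ι := by
    rintro k ⟨b, r, c, h⟩
    have hu : IsUnit ((P.map (eval b)).submatrix r c) :=
      (Matrix.isUnit_iff_isUnit_det _).mpr (isUnit_iff_ne_zero.mpr h)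
    have h1 := Matrix.rank_of_isUnit _ hu
    have h2 := Matrix.rank_submatrix_le (P.map (eval b)) r c
    have h3 := Matrix.rank_le_card_width (P.map (eval b))
    rw [h1, Fintype.card_fin] at h2
    exact h2.trans h3
  obtain ⟨ρ, hρ⟩ : ∃ ρ, ρ = Nat.findGreatest Good (Fintype.card ι) := ⟨_, rfl⟩
  have hGoodρ : Good ρ := hρ ▸ Nat.findGreatest_spec (P := Good) (Nat.zero_le _) hGood0
  have hmax : ¬ Good (ρ + 1) := by
    intro h
    have h1 := Nat.le_findGreatest (hbound _ h) h
    rw [← hρ] at h1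
    omega
  obtain ⟨a, rI, cI, ha⟩ := hGoodρ
  have hmin : ∀ (b : σ → F) (r' c' : Fin (ρ + 1) → ι),
      ((P.map (eval b)).submatrix r' c').det = 0 := by
    intro b r' c'
    by_contra h
    exact hmax ⟨b, r', c', h⟩
  refine ⟨ρ, a, rI, cI, ?_, ?_, hmin, ?_⟩
  · rwa [eval_det_submatrix]
  · have hu : IsUnit ((P.map (eval a)).submatrix rI cI) :=
      (Matrix.isUnit_iff_isUnit_det _).mpr (isUnit_iff_ne_zero.mpr ha)
    have h1 := Matrix.rank_of_isUnit _ hu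
    have h2 := Matrix.rank_submatrix_le (P.map (eval a)) rI cI
    rw [h1, Fintype.card_fin] at h2
    exact h2
  · have hδ : (P.submatrix rI cI).det ≠ 0 := by
      intro h0
      apply ha
      rw [← eval_det_submatrix, h0, map_zero]
    rw [← sub_eq_zero]
    refine Matrix.ext fun i j => ?_
    have h : (P.submatrix rI cI).det * ((P.submatrix rI cI).det * P i j -
        (P.submatrix id cI * (P.submatrix rI cI).adjugate * P.submatrix rI id) i j) = 0 := by
      apply MvPolynomial.funext
      intro b
      simp only [map_mul, map_sub, map_zero]
      by_cases hb : eval b (P.submatrix rI cI).det = 0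
      · rw [hb, zero_mul]
      · have hb' : ((P.map (eval b)).submatrix rI cI).det ≠ 0 := by
          rwa [← eval_det_submatrix]
        have key := det_mul_apply_eq_of_minors_vanish (P.map (eval b)) rI cI hb' (hmin b) i j
        rw [← eval_det_submatrix] at key
        rw [eval_colAdjRow_apply, ← key, Matrix.map_apply, sub_self, mul_zero]
    have h' := (mul_eq_zero.mp h).resolve_left hδ
    simpa [Matrix.sub_apply, Matrix.smul_apply, smul_eq_mul] using h'

end MaxMinor

/-! ## Translation and the truncated inverse (Lemma 3.2, first half) -/

section Translate

variable {F : Type*} [Field F] {σ : Type*}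

/-- Evaluating the translate `p(x + a)` (the image of `p` under the ring map `X v ↦ X v + C (a v)`)
at `b` gives `p(b + a)`. [folklore] -/
theorem eval_translate (a b : σ → F) (p : MvPolynomial σ F) :
    eval b (eval₂Hom C (fun v => X v + C (a v)) p) = eval (b + a) p := by
  induction p using MvPolynomial.induction_on with
  | C c => simp
  | add p q hp hq => simp only [map_add, hp, hq]
  | mul_X p v hp => simp only [map_mul, hp, eval₂Hom_X', map_add, eval_X, eval_C, Pi.add_apply]

/-- The constant coefficient of the translate `p(x + a)` is `p(a)`. [folklore] -/
theorem constantCoeff_translate (a : σ → F) (p : MvPolynomial σ F) :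
    constantCoeff (eval₂Hom C (fun v => X v + C (a v)) p) = eval a p := by
  rw [← eval_zero, eval_translate, zero_add]

variable [Infinite F] {ι : Type*} [Fintype ι]

/-- **Translated low-rank decomposition with polynomial entries** (EGOW 2018, Lemma 3.2, first
half, for an arbitrary truncation order `D`). For `P ∈ Mat_ι(F[x])` over an infinite field there
are `ρ ≤ rank P(a)` (for the chosen base point `a`; in particular `ρ ≤ r` whenever all
evaluations have rank `≤ r`), columns `cI`, a polynomial matrix `B'` with `ρ` rows and a polynomial
`ε` without constant term such that, writing `P'(x) = P(x + a)`,
`P' = P'[·, cI] · B' + ε^{D+1} • P'`. [cite: EfremenkoGargOliveiraWigderson2018, Lemma 3.2] -/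
theorem exists_translate_decomposition (P : Matrix ι ι (MvPolynomial σ F)) (D : ℕ) :
    ∃ (ρ : ℕ) (a : σ → F) (cI : Fin ρ → ι) (B' : Matrix (Fin ρ) ι (MvPolynomial σ F))
      (ε : MvPolynomial σ F),
      ρ ≤ (P.map (eval a)).rank ∧ constantCoeff ε = 0 ∧
      P.map (eval₂Hom C (fun v => X v + C (a v))) =
        (P.map (eval₂Hom C (fun v => X v + C (a v)))).submatrix id cI * B' +
          ε ^ (D + 1) • P.map (eval₂Hom C (fun v => X v + C (a v))) := by
  obtain ⟨ρ, a, rI, cI, ha, hrank, -, hP⟩ := exists_maxMinor_factorization P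
  obtain ⟨τ, hτ⟩ : ∃ τ : MvPolynomial σ F →+* MvPolynomial σ F,
      τ = eval₂Hom C (fun v => X v + C (a v)) := ⟨_, rfl⟩
  obtain ⟨δ, hδ⟩ : ∃ δ : MvPolynomial σ F, δ = (P.submatrix rI cI).det := ⟨_, rfl⟩
  rw [← hδ] at ha hP
  refine ⟨ρ, a, cI, ?_⟩
  rw [← hτ]
  have hc0 : eval a δ ≠ 0 := ha
  -- the translated identity
  have hP1 : τ δ • P.map τ =
      (P.map τ).submatrix id cI * ((P.map τ).submatrix rI cI).adjugate *
        (P.map τ).submatrix rI id := by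
    have h := congrArg (fun A : Matrix ι ι (MvPolynomial σ F) => A.map τ) hP
    have hs : (δ • P).map τ = τ δ • P.map τ := by
      refine Matrix.ext fun i j => ?_
      simp [Matrix.map_apply, smul_eq_mul]
    rw [hs, Matrix.map_mul, Matrix.map_mul, ← RingHom.mapMatrix_apply τ (P.submatrix rI cI).adjugate,
      RingHom.map_adjugate, RingHom.mapMatrix_apply] at h
    rw [h]
    simp only [← Matrix.submatrix_map]
  -- ε and the truncated inverse
  obtain ⟨c, hc⟩ : ∃ c : F, c = eval a δ := ⟨_, rfl⟩
  have hc0' : c ≠ 0 := hc ▸ hc0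
  obtain ⟨ε, hε⟩ : ∃ ε : MvPolynomial σ F, ε = 1 - C c⁻¹ * τ δ := ⟨_, rfl⟩
  have h1ε : C c⁻¹ * τ δ = 1 - ε := by rw [hε, sub_sub_cancel]
  refine ⟨(C c⁻¹ * ∑ k ∈ Finset.range (D + 1), ε ^ k) •
      (((P.map τ).submatrix rI cI).adjugate * (P.map τ).submatrix rI id), ε, hrank, ?_, ?_⟩
  · rw [hε, map_sub, map_one, map_mul, constantCoeff_C, hτ, constantCoeff_translate, ← hc,
      inv_mul_cancel₀ hc0', sub_self]
  · have hginv : (C c⁻¹ * ∑ k ∈ Finset.range (D + 1), ε ^ k) * τ δ = 1 - ε ^ (D + 1) := by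
      rw [mul_comm (C c⁻¹), mul_assoc, h1ε, geom_sum_mul_neg]
    have h2 : (1 - ε ^ (D + 1)) • P.map τ =
        (P.map τ).submatrix id cI * ((C c⁻¹ * ∑ k ∈ Finset.range (D + 1), ε ^ k) •
          (((P.map τ).submatrix rI cI).adjugate * (P.map τ).submatrix rI id)) := by
      rw [Matrix.mul_smul, ← Matrix.mul_assoc, ← hP1, smul_smul, hginv]
    rw [sub_smul, one_smul, sub_eq_iff_eq_add] at h2
    exact h2

end Translate

end Literature.Computability.AlgebraicComplexity
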